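import Literature.AlgebraicGeometry.HodgeTheory.FlatSectionNonvanishing
import Literature.AlgebraicGeometry.HodgeTheory.MotivatedClassesDeformationInputs
import Literature.AlgebraicGeometry.HodgeTheory.SurjectiveMorphismBettiHodgeNumbers
import HarnessLib

/-!
# Betti numbers are constant in smooth projective families (Ehresmann): `b_k(X_s) = b_k(X_t)` for points `s, t` of the base joined
# by a path

[topic AlgebraicGeometry/HodgeTheory]

Layer `Literature/AlgebraicGeometry/HodgeTheory`. THEOREMS ONLY (no definition, no named fact, no instance, no notation). Written for
the cell `hodge-nonav` (prover seat `hodge-nonav-prover-Bx` g20; route `Q8SymplecticPowers`, crux K1Q stub S1 `stub_regularVeryGeneralQ`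
«very generally every smooth model is regular, `b₁ = 0`»: together with the birational invariance of `b₁` (`BettiOneBirationalInvariance`) it
reduces S1 to `b₁ = 0` for ONE fibre of the deck family model), route-agnostic. Inputs (tree theorems): parallel transport
`transportLinear` of `Hᵏ(X_s(ℂ); ℂ)` along homotopy classes of paths in a cohomologically locally trivial set of base points is injective
(`transportFun_injective`, Voisin I §9.2.1), Ehresmann on complex points (`isCohomologicallyLocallyTrivialOn_univ_of_isSmoothProjectiveFamily`),
universal coefficients `dim_ℂ Hᵏ(ℂ) = dim_ℚ Hᵏ(ℚ)` (`finrank_complexBetti_eq_finrank_bettiCohomology`).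

* `finrank_complexBetti_fiberOver_eq_of_transport` — along a homotopy class of paths inside a cohomologically locally trivial `U`.
* **`finrank_bettiCohomology_fiberOver_eq_of_joined`** — `b_k(X_s) = b_k(X_t)` for a smooth projective family over a smooth
  quasi-projective base and `s, t` joined by a path in `S(ℂ)`.

[cite: VoisinHodgeI2002, §9.1.1 Thm. 9.3 (Ehresmann) and §9.2.1] [cite: HatcherAT2002, §3.1 Thm. 3.2]

Honest scope: topology of families; nothing here proves S1 or HC.
-/

noncomputable section

open CategoryTheory AlgebraicGeometry Literature.AlgebraicGeometry Literature.AlgebraicGeometry.Motives Literature.AlgebraicGeometry.HodgeTheory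

namespace Literature.AlgebraicGeometry.HodgeTheory

variable {𝒳 S : SchemeOver ℂ} (π : 𝒳 ⟶ S)

/-- **`dim Hᵏ(X_s(ℂ); ℂ) = dim Hᵏ(X_t(ℂ); ℂ)` along a homotopy class of paths in a cohomologically locally trivial set of base points**
(transport along `γ` and along `γ⁻¹` are injective linear maps between finite-dimensional spaces). [cite: VoisinHodgeI2002, §9.2.1] -/
theorem finrank_complexBetti_fiberOver_eq_of_transport {U : Set (Motives.ComplexPoints S)} (hU : IsCohomologicallyLocallyTrivialOn π U)
    (k : ℕ) {s t : U} (γ : Path.Homotopic.Quotient s t) [Module.Finite ℂ (complexBetti (Motives.fiberOver π s.1) k)]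
    [Module.Finite ℂ (complexBetti (Motives.fiberOver π t.1) k)] :
    Module.finrank ℂ (complexBetti (Motives.fiberOver π s.1) k) = Module.finrank ℂ (complexBetti (Motives.fiberOver π t.1) k) := by
  refine le_antisymm ?_ ?_
  · exact LinearMap.finrank_le_finrank_of_injective (f := transportLinear π k hU γ) (transportFun_injective π k hU γ)
  · exact LinearMap.finrank_le_finrank_of_injective (f := transportLinear π k hU γ.symm) (transportFun_injective π k hU γ.symm)

/-- **Ehresmann: `b_k(X_s) = b_k(X_t)` in a smooth projective family** `π : 𝒳 → S` of relative dimension `n` over a quasi-projective base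
smooth of some dimension `d`, for base points `s, t ∈ S(ℂ)` joined by a path (rational Betti numbers of the fibres; transport on `Hᵏ(−; ℂ)` +
universal coefficients). [cite: VoisinHodgeI2002, §9.1.1 Thm. 9.3 and §9.2.1] [cite: HatcherAT2002, §3.1 Thm. 3.2] -/
theorem finrank_bettiCohomology_fiberOver_eq_of_joined {n d : ℕ} (hπ : Motives.IsSmoothProjectiveFamily π n)
    (hS : IsQuasiProjectiveOver S) [SmoothOfRelativeDimension d S.hom] {s t : Motives.ComplexPoints S} (hst : Joined s t) (k : ℕ) :
    Module.finrank ℚ (bettiCohomology (Motives.fiberOver π s) k) = Module.finrank ℚ (bettiCohomology (Motives.fiberOver π t) k) := by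
  have hU := isCohomologicallyLocallyTrivialOn_univ_of_isSmoothProjectiveFamily π d hπ hS
  haveI := finite_complexBetti (hπ.isSmoothProjective s) k
  haveI := finite_complexBetti (hπ.isSmoothProjective t) k
  obtain ⟨p⟩ := hst
  let p' : Path (⟨s, Set.mem_univ s⟩ : (Set.univ : Set (Motives.ComplexPoints S))) ⟨t, Set.mem_univ t⟩ :=
    ⟨⟨fun x ↦ ⟨p x, Set.mem_univ _⟩, by fun_prop⟩, by ext; simp, by ext; simp⟩
  have h := finrank_complexBetti_fiberOver_eq_of_transport π hU k (s := ⟨s, Set.mem_univ s⟩) (t := ⟨t, Set.mem_univ t⟩) ⟦p'⟧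
  rw [← finrank_complexBetti_eq_finrank_bettiCohomology, ← finrank_complexBetti_eq_finrank_bettiCohomology]
  exact h

end Literature.AlgebraicGeometry.HodgeTheory

end
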